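import Mathlib
import HarnessLib
import Summits.HubbardSuperconductivity.HubbardSuperconductivity.Theorems.KLProgrammeH10TwoPointLimitLineDerivTwo

/-!
# Route `KLProgramme` — engine support, route (L2) symbol layer (b₂): first and second LINE derivatives of a sector-multiplier
# symbol `G(φ² + c)·Z` (cutoff PROFILE of the squared denominator × angular/line factor), anisotropic first-order term explicit

Cell `gate-hubbard-kl`, seat p4 (C5a lead), g6; HOME/prover-p4/FRAME-L22-NOTE.md §3″ (b₂); k3c2-p3 / p4 split 2026-08-26T22:05Z (ADDITIVE
weight ⇒ only single-direction second differences of the sampled symbol ⇒ only second LINE derivatives of the continuum symbol ⇒ only `C²`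
data of the band on an admissible frame).  The engine's multipliers (`bgmMultiplier` = `klAnisoFamily`, `klIsoFamily`, thickenings, pairwise
products) are `Φ(k₀, p) = G(k₀² + e(p)²)·Z(p)` with `G` a profile supported in `[0, Λ²]`, `|G′| ≤ g₁/Λ²`, `|G″| ≤ g₂/Λ⁴` (`H₀(4ⁿ√u) =
bgmCutoffSq e₀ (16ⁿu)`, `Λ = e₀4^{-n}`; products of two profiles are profiles at the finer scale, `profile_mul`), `e` the band, `Z` the angular
factor.  Along a spatial line `p = q + s•w`: `f(s) = G(φ(s)² + c)·Z(s)`, `φ(s) = e(q + s•w)`, `c = k₀²`; along the Matsubara line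
`φ(s) = k₀ + s h₀`, `c = e(p)²`, `Z` constant.  For `G, φ, Z ∈ C²`:
* §1 `iteratedDeriv_two_comp₂` — `(G∘ψ)″ = G″(ψ)ψ′² + G′(ψ)ψ″`; the inner map `ψ = φ² + c`;
* §2 `abs_deriv_radialComp_le`, `abs_iteratedDeriv_two_radialComp_le` — `A = G(φ² + c)`: `|A′| ≤ 2g₁|φ′|/Λ`,
  `|A″| ≤ (4g₂ + 2g₁)φ′²/Λ² + 2g₁|φ″|/Λ` (on the support `|φ| ≤ Λ` absorbs one `φ` per `G`-derivative); `radialComp_eq_zero_of_lt`;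
* §3 **`abs_iteratedDeriv_two_radialComp_mul_le`** — `f = A·Z`:
  `|f″| ≤ [(4g₂+2g₁)φ′²/Λ² + 2g₁|φ″|/Λ]·|Z| + 4g₁|φ′|/Λ·|Z′| + g₀|Z″|` POINTWISE (orders `0, 1` too; vanishing off the support);
* §4 SPACE line on a normed space (`‖D²e‖ ≤ K₂`): `|φ′(s)| = |De(q+s•w)·w|` (small for `w` along the Fermi curve), `|φ″| ≤ K₂‖w‖²`:
  **`abs_iteratedDeriv_two_symbol_spaceLine_le`**; §5 TIME line: **`abs_iteratedDeriv_two_symbol_timeLine_le`**; §6 `profile_mul`.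

Everything is proved; no definitions, no named facts. [folklore]  (Benfatto–Giuliani–Mastropietro 2006, proof of Lemma 2.2, (2.53)–(2.55):
each derivative costs `γ^{-h}` in the normal and `γ^{-h/2}` in the tangential direction.)
-/

noncomputable section

namespace Summit.HubbardSuperconductivity.HubbardSuperconductivity.Theorems.TorusFourierL2

set_option linter.dupNamespace false -- summit = problem name (single-conjunct summit), D-0017

open Filter Topology

/-! ### §1 Composition of two `C²` functions of one variable -/

/-- **Chain rule** for `C²` functions: `HasDerivAt (G ∘ ψ) (G′(ψ s)·ψ′ s) s`. [folklore] -/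
theorem hasDerivAt_comp₂ {G ψ : ℝ → ℝ} (hG : ContDiff ℝ 2 G) (hψ : ContDiff ℝ 2 ψ) (s : ℝ) :
    HasDerivAt (fun s => G (ψ s)) (deriv G (ψ s) * deriv ψ s) s := by
  have h2 : (2 : WithTop ℕ∞) ≠ 0 := by norm_num
  exact (((hG.differentiable h2) _).hasDerivAt).comp s ((hψ.differentiable h2) s).hasDerivAt

/-- `(G ∘ ψ)′ = G′(ψ)·ψ′`. [folklore] -/
theorem deriv_comp₂ {G ψ : ℝ → ℝ} (hG : ContDiff ℝ 2 G) (hψ : ContDiff ℝ 2 ψ) :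
    deriv (fun s => G (ψ s)) = fun s => deriv G (ψ s) * deriv ψ s :=
  funext fun s => (hasDerivAt_comp₂ hG hψ s).deriv

/-- **Second derivative of a composition**: `(G ∘ ψ)″(s) = G″(ψ s)·ψ′(s)² + G′(ψ s)·ψ″(s)`. [folklore] -/
theorem iteratedDeriv_two_comp₂ {G ψ : ℝ → ℝ} (hG : ContDiff ℝ 2 G) (hψ : ContDiff ℝ 2 ψ) (s : ℝ) :
    iteratedDeriv 2 (fun s => G (ψ s)) s = iteratedDeriv 2 G (ψ s) * deriv ψ s ^ 2 + deriv G (ψ s) * iteratedDeriv 2 ψ s := by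
  have h2 : (2 : WithTop ℕ∞) ≠ 0 := by norm_num
  rw [iteratedDeriv_succ, iteratedDeriv_one, deriv_comp₂ hG hψ]
  have hψ1 : HasDerivAt ψ (deriv ψ s) s := ((hψ.differentiable h2) s).hasDerivAt
  have hA : HasDerivAt (fun s => deriv G (ψ s)) (iteratedDeriv 2 G (ψ s) * deriv ψ s) s :=
    (hasDerivAt_deriv_of_contDiff_two hG (ψ s)).comp s hψ1
  have hB : HasDerivAt (fun s => deriv ψ s) (iteratedDeriv 2 ψ s) s := hasDerivAt_deriv_of_contDiff_two hψ s
  have hAB : HasDerivAt (fun s => deriv G (ψ s) * deriv ψ s)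
      (iteratedDeriv 2 G (ψ s) * deriv ψ s * deriv ψ s + deriv G (ψ s) * iteratedDeriv 2 ψ s) s := hA.mul hB
  rw [hAB.deriv]
  ring

/-- The inner map `ψ = φ² + c` is `C²`. [folklore] -/
theorem contDiff_two_sq_add {φ : ℝ → ℝ} (hφ : ContDiff ℝ 2 φ) (c : ℝ) : ContDiff ℝ 2 fun s => φ s ^ 2 + c :=
  (hφ.pow 2).add contDiff_const

/-- `(φ² + c)′ = 2φφ′`. [folklore] -/
theorem deriv_sq_add {φ : ℝ → ℝ} (hφ : ContDiff ℝ 2 φ) (c s : ℝ) :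
    deriv (fun s => φ s ^ 2 + c) s = 2 * φ s * deriv φ s := by
  have h2 : (2 : WithTop ℕ∞) ≠ 0 := by norm_num
  have hφ1 : HasDerivAt φ (deriv φ s) s := ((hφ.differentiable h2) s).hasDerivAt
  have e2 : (fun s => φ s ^ 2 + c) = fun s => φ s * φ s + c := by funext s; ring
  have h : HasDerivAt (fun s => φ s * φ s + c) (deriv φ s * φ s + φ s * deriv φ s) s := (hφ1.mul hφ1).add_const c
  rw [e2, h.deriv]
  ring

/-- `(φ² + c)″ = 2φ′² + 2φφ″`. [folklore] -/
theorem iteratedDeriv_two_sq_add {φ : ℝ → ℝ} (hφ : ContDiff ℝ 2 φ) (c s : ℝ) :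
    iteratedDeriv 2 (fun s => φ s ^ 2 + c) s = 2 * deriv φ s ^ 2 + 2 * φ s * iteratedDeriv 2 φ s := by
  have h2 : (2 : WithTop ℕ∞) ≠ 0 := by norm_num
  rw [iteratedDeriv_succ, iteratedDeriv_one]
  have hd : deriv (fun s => φ s ^ 2 + c) = fun s => 2 * φ s * deriv φ s := funext fun s => deriv_sq_add hφ c s
  rw [hd]
  have hφ1 : HasDerivAt φ (deriv φ s) s := ((hφ.differentiable h2) s).hasDerivAt
  have hB : HasDerivAt (fun s => deriv φ s) (iteratedDeriv 2 φ s) s := hasDerivAt_deriv_of_contDiff_two hφ s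
  have h : HasDerivAt (fun s => 2 * φ s * deriv φ s) (2 * deriv φ s * deriv φ s + 2 * φ s * iteratedDeriv 2 φ s) s :=
    (hφ1.const_mul 2).mul hB
  rw [h.deriv]
  ring

/-! ### §2 The radial composition `A(s) = G(φ(s)² + c)` for a cutoff profile `G` -/

/-- A function vanishing on the open half-line `(Λ², ∞)` has vanishing first and second derivatives there. [folklore] -/
theorem deriv_eq_zero_of_vanish {G : ℝ → ℝ} {Λ : ℝ} (hGv : ∀ u, Λ ^ 2 < u → G u = 0) {u : ℝ} (hu : Λ ^ 2 < u) :
    deriv G u = 0 ∧ iteratedDeriv 2 G u = 0 := by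
  have hev : G =ᶠ[𝓝 u] fun _ => (0 : ℝ) := by
    filter_upwards [Ioi_mem_nhds hu] with v hv using hGv v hv
  refine ⟨?_, ?_⟩
  · rw [hev.deriv_eq, deriv_const]
  · rw [hev.iteratedDeriv_eq, iteratedDeriv_const]
    simp

/-- On the support of a profile the inner variable is below the scale: `φ² + c ≤ Λ²`, `c ≥ 0` `⇒ |φ| ≤ Λ`. [folklore] -/
theorem abs_le_of_sq_add_le {φ c Λ : ℝ} (hc : 0 ≤ c) (hΛ : 0 ≤ Λ) (h : φ ^ 2 + c ≤ Λ ^ 2) : |φ| ≤ Λ :=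
  abs_le_of_sq_le_sq' (by nlinarith) hΛ |> fun h' => abs_le.2 h'

/-- **The radial composition vanishes off the support**, together with its first two derivatives:
`Λ² < φ(s)² + c ⇒ A(s) = A′(s) = A″(s) = 0`. [folklore] -/
theorem radialComp_eq_zero_of_lt {G φ : ℝ → ℝ} (hG : ContDiff ℝ 2 G) (hφ : ContDiff ℝ 2 φ) {Λ : ℝ}
    (hGv : ∀ u, Λ ^ 2 < u → G u = 0) (c : ℝ) {s : ℝ} (hs : Λ ^ 2 < φ s ^ 2 + c) :
    G (φ s ^ 2 + c) = 0 ∧ deriv (fun s => G (φ s ^ 2 + c)) s = 0 ∧ iteratedDeriv 2 (fun s => G (φ s ^ 2 + c)) s = 0 := by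
  obtain ⟨h1, h2⟩ := deriv_eq_zero_of_vanish hGv hs
  refine ⟨hGv _ hs, ?_, ?_⟩
  · rw [deriv_comp₂ hG (contDiff_two_sq_add hφ c)]
    simp [h1]
  · rw [iteratedDeriv_two_comp₂ hG (contDiff_two_sq_add hφ c), h1, h2]
    ring

/-- **First derivative of the radial composition**: `|A′(s)| ≤ 2g₁|φ′(s)|/Λ` when `|G′| ≤ g₁/Λ²` and `G` vanishes above `Λ²`
(`c ≥ 0`, `Λ > 0`). [cite: BenfattoGiulianiMastropietro2006, §2.5 proof of Lemma 2.2 (2.53)–(2.55)] -/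
theorem abs_deriv_radialComp_le {G φ : ℝ → ℝ} (hG : ContDiff ℝ 2 G) (hφ : ContDiff ℝ 2 φ) {Λ g₁ : ℝ} (hΛ : 0 < Λ)
    (hg₁ : 0 ≤ g₁) (hG1 : ∀ u, |deriv G u| ≤ g₁ / Λ ^ 2) (hGv : ∀ u, Λ ^ 2 < u → G u = 0) {c : ℝ} (hc : 0 ≤ c) (s : ℝ) :
    |deriv (fun s => G (φ s ^ 2 + c)) s| ≤ 2 * g₁ * |deriv φ s| / Λ := by
  by_cases hs : Λ ^ 2 < φ s ^ 2 + c
  · rw [(radialComp_eq_zero_of_lt hG hφ hGv c hs).2.1, abs_zero]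
    positivity
  · push Not at hs
    have hφΛ : |φ s| ≤ Λ := abs_le_of_sq_add_le hc hΛ.le hs
    rw [deriv_comp₂ hG (contDiff_two_sq_add hφ c)]
    dsimp only
    rw [deriv_sq_add hφ c s, abs_mul, abs_mul, abs_mul, abs_two]
    have h1 := hG1 (φ s ^ 2 + c)
    have hφ' := abs_nonneg (deriv φ s)
    calc |deriv G (φ s ^ 2 + c)| * (2 * |φ s| * |deriv φ s|) ≤ (g₁ / Λ ^ 2) * (2 * Λ * |deriv φ s|) := by
          refine mul_le_mul h1 (by nlinarith) (by positivity) (by positivity)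
      _ = 2 * g₁ * |deriv φ s| / Λ := by field_simp

/-- **Second derivative of the radial composition**: `|A″(s)| ≤ (4g₂ + 2g₁)φ′(s)²/Λ² + 2g₁|φ″(s)|/Λ`.
[cite: BenfattoGiulianiMastropietro2006, §2.5 proof of Lemma 2.2 (2.53)–(2.55)] -/
theorem abs_iteratedDeriv_two_radialComp_le {G φ : ℝ → ℝ} (hG : ContDiff ℝ 2 G) (hφ : ContDiff ℝ 2 φ) {Λ g₁ g₂ : ℝ}
    (hΛ : 0 < Λ) (hg₁ : 0 ≤ g₁) (hg₂ : 0 ≤ g₂) (hG1 : ∀ u, |deriv G u| ≤ g₁ / Λ ^ 2)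
    (hG2 : ∀ u, |iteratedDeriv 2 G u| ≤ g₂ / Λ ^ 4) (hGv : ∀ u, Λ ^ 2 < u → G u = 0) {c : ℝ} (hc : 0 ≤ c) (s : ℝ) :
    |iteratedDeriv 2 (fun s => G (φ s ^ 2 + c)) s| ≤
      (4 * g₂ + 2 * g₁) * deriv φ s ^ 2 / Λ ^ 2 + 2 * g₁ * |iteratedDeriv 2 φ s| / Λ := by
  by_cases hs : Λ ^ 2 < φ s ^ 2 + c
  · rw [(radialComp_eq_zero_of_lt hG hφ hGv c hs).2.2, abs_zero]
    positivity
  · push Not at hs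
    have hφΛ : |φ s| ≤ Λ := abs_le_of_sq_add_le hc hΛ.le hs
    rw [iteratedDeriv_two_comp₂ hG (contDiff_two_sq_add hφ c)]
    rw [deriv_sq_add hφ c s, iteratedDeriv_two_sq_add hφ c s]
    have h1 := hG1 (φ s ^ 2 + c)
    have h2 := hG2 (φ s ^ 2 + c)
    have hsq : φ s ^ 2 ≤ Λ ^ 2 := by
      have := sq_abs (φ s); rw [← this]; exact pow_le_pow_left₀ (abs_nonneg _) hφΛ 2
    -- first term
    have hT1 : |iteratedDeriv 2 G (φ s ^ 2 + c) * (2 * φ s * deriv φ s) ^ 2| ≤ 4 * g₂ * deriv φ s ^ 2 / Λ ^ 2 := by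
      rw [abs_mul, abs_sq]
      have e1 : (2 * φ s * deriv φ s) ^ 2 = 4 * φ s ^ 2 * deriv φ s ^ 2 := by ring
      rw [e1]
      calc |iteratedDeriv 2 G (φ s ^ 2 + c)| * (4 * φ s ^ 2 * deriv φ s ^ 2) ≤ (g₂ / Λ ^ 4) * (4 * Λ ^ 2 * deriv φ s ^ 2) := by
            refine mul_le_mul h2 ?_ (by positivity) (by positivity)
            nlinarith [sq_nonneg (deriv φ s)]
        _ = 4 * g₂ * deriv φ s ^ 2 / Λ ^ 2 := by field_simp
    -- second term
    have hT2 : |deriv G (φ s ^ 2 + c) * (2 * deriv φ s ^ 2 + 2 * φ s * iteratedDeriv 2 φ s)| ≤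
        2 * g₁ * deriv φ s ^ 2 / Λ ^ 2 + 2 * g₁ * |iteratedDeriv 2 φ s| / Λ := by
      rw [abs_mul]
      have hin : |2 * deriv φ s ^ 2 + 2 * φ s * iteratedDeriv 2 φ s| ≤ 2 * deriv φ s ^ 2 + 2 * Λ * |iteratedDeriv 2 φ s| := by
        calc _ ≤ |2 * deriv φ s ^ 2| + |2 * φ s * iteratedDeriv 2 φ s| := abs_add_le _ _
          _ = 2 * deriv φ s ^ 2 + 2 * |φ s| * |iteratedDeriv 2 φ s| := by
              rw [abs_of_nonneg (by positivity), abs_mul, abs_mul, abs_two]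
          _ ≤ 2 * deriv φ s ^ 2 + 2 * Λ * |iteratedDeriv 2 φ s| := by
              nlinarith [abs_nonneg (iteratedDeriv 2 φ s)]
      calc |deriv G (φ s ^ 2 + c)| * |2 * deriv φ s ^ 2 + 2 * φ s * iteratedDeriv 2 φ s|
          ≤ (g₁ / Λ ^ 2) * (2 * deriv φ s ^ 2 + 2 * Λ * |iteratedDeriv 2 φ s|) :=
            mul_le_mul h1 hin (abs_nonneg _) (by positivity)
        _ = 2 * g₁ * deriv φ s ^ 2 / Λ ^ 2 + 2 * g₁ * |iteratedDeriv 2 φ s| / Λ := by field_simp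
    calc _ ≤ |iteratedDeriv 2 G (φ s ^ 2 + c) * (2 * φ s * deriv φ s) ^ 2| +
          |deriv G (φ s ^ 2 + c) * (2 * deriv φ s ^ 2 + 2 * φ s * iteratedDeriv 2 φ s)| := abs_add_le _ _
      _ ≤ 4 * g₂ * deriv φ s ^ 2 / Λ ^ 2 + (2 * g₁ * deriv φ s ^ 2 / Λ ^ 2 + 2 * g₁ * |iteratedDeriv 2 φ s| / Λ) :=
          add_le_add hT1 hT2
      _ = _ := by ring

/-! ### §3 Times a `C²` line factor `Z` -/

/-- Product rule, first derivative (`C²` data). [folklore] -/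
theorem deriv_mul₂ {A Z : ℝ → ℝ} (hA : ContDiff ℝ 2 A) (hZ : ContDiff ℝ 2 Z) (s : ℝ) :
    deriv (fun s => A s * Z s) s = deriv A s * Z s + A s * deriv Z s := by
  have h2 : (2 : WithTop ℕ∞) ≠ 0 := by norm_num
  have hA1 : HasDerivAt A (deriv A s) s := ((hA.differentiable h2) s).hasDerivAt
  have hZ1 : HasDerivAt Z (deriv Z s) s := ((hZ.differentiable h2) s).hasDerivAt
  have h : HasDerivAt (fun s => A s * Z s) (deriv A s * Z s + A s * deriv Z s) s := hA1.mul hZ1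
  rw [h.deriv]

/-- **Leibniz at order two** (`C²` data): `(AZ)″ = A″Z + 2A′Z′ + AZ″`. [folklore] -/
theorem iteratedDeriv_two_mul₂ {A Z : ℝ → ℝ} (hA : ContDiff ℝ 2 A) (hZ : ContDiff ℝ 2 Z) (s : ℝ) :
    iteratedDeriv 2 (fun s => A s * Z s) s =
      iteratedDeriv 2 A s * Z s + 2 * (deriv A s * deriv Z s) + A s * iteratedDeriv 2 Z s := by
  have h2 : (2 : WithTop ℕ∞) ≠ 0 := by norm_num
  rw [iteratedDeriv_succ, iteratedDeriv_one]
  have hd : deriv (fun s => A s * Z s) = fun s => deriv A s * Z s + A s * deriv Z s := funext fun s => deriv_mul₂ hA hZ s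
  rw [hd]
  have hA1 : HasDerivAt A (deriv A s) s := ((hA.differentiable h2) s).hasDerivAt
  have hZ1 : HasDerivAt Z (deriv Z s) s := ((hZ.differentiable h2) s).hasDerivAt
  have hA2 : HasDerivAt (fun s => deriv A s) (iteratedDeriv 2 A s) s := hasDerivAt_deriv_of_contDiff_two hA s
  have hZ2 : HasDerivAt (fun s => deriv Z s) (iteratedDeriv 2 Z s) s := hasDerivAt_deriv_of_contDiff_two hZ s
  have h : HasDerivAt (fun s => deriv A s * Z s + A s * deriv Z s)
      (iteratedDeriv 2 A s * Z s + deriv A s * deriv Z s + (deriv A s * deriv Z s + A s * iteratedDeriv 2 Z s)) s :=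
    (hA2.mul hZ1).add (hA1.mul hZ2)
  rw [h.deriv]
  ring

/-- The product of the radial composition with a `C²` factor is `C²` (the hypothesis of `norm_fwdDiff_iter_apply_le_of_line`).
[folklore] -/
theorem contDiff_two_radialComp_mul {G φ Z : ℝ → ℝ} (hG : ContDiff ℝ 2 G) (hφ : ContDiff ℝ 2 φ) (hZ : ContDiff ℝ 2 Z)
    (c : ℝ) : ContDiff ℝ 2 fun s => G (φ s ^ 2 + c) * Z s :=
  (hG.comp (contDiff_two_sq_add hφ c)).mul hZ

/-- **Order zero**: `|G(φ² + c)·Z| ≤ g₀|Z|`, and `= 0` off the support. [folklore] -/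
theorem abs_radialComp_mul_le {G φ Z : ℝ → ℝ} {g₀ : ℝ} (hG0 : ∀ u, |G u| ≤ g₀) (c s : ℝ) :
    |G (φ s ^ 2 + c) * Z s| ≤ g₀ * |Z s| := by
  rw [abs_mul]
  exact mul_le_mul_of_nonneg_right (hG0 _) (abs_nonneg _)

/-- **The symbol and its first two line derivatives vanish off the cutoff support** `{φ² + c ≤ Λ²}`. [folklore] -/
theorem radialComp_mul_eq_zero_of_lt {G φ Z : ℝ → ℝ} (hG : ContDiff ℝ 2 G) (hφ : ContDiff ℝ 2 φ) (hZ : ContDiff ℝ 2 Z)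
    {Λ : ℝ} (hGv : ∀ u, Λ ^ 2 < u → G u = 0) (c : ℝ) {s : ℝ} (hs : Λ ^ 2 < φ s ^ 2 + c) :
    G (φ s ^ 2 + c) * Z s = 0 ∧ deriv (fun s => G (φ s ^ 2 + c) * Z s) s = 0 ∧
      iteratedDeriv 2 (fun s => G (φ s ^ 2 + c) * Z s) s = 0 := by
  obtain ⟨h0, h1, h2⟩ := radialComp_eq_zero_of_lt hG hφ hGv c hs
  have hA : ContDiff ℝ 2 (fun s => G (φ s ^ 2 + c)) := hG.comp (contDiff_two_sq_add hφ c)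
  refine ⟨by rw [h0, zero_mul], ?_, ?_⟩
  · rw [deriv_mul₂ hA hZ s]
    simp only [h0, zero_mul, add_zero]
    rw [show deriv (fun s => G (φ s ^ 2 + c)) s = 0 from h1, zero_mul]
  · rw [iteratedDeriv_two_mul₂ hA hZ s]
    rw [show iteratedDeriv 2 (fun s => G (φ s ^ 2 + c)) s = 0 from h2, show deriv (fun s => G (φ s ^ 2 + c)) s = 0 from h1,
      h0]
    ring

/-- **Order one**: `|f′(s)| ≤ 2g₁|φ′(s)|/Λ·|Z(s)| + g₀|Z′(s)|`. [cite: BenfattoGiulianiMastropietro2006, §2.5 proof of Lemma 2.2 (2.53)–(2.55)] -/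
theorem abs_deriv_radialComp_mul_le {G φ Z : ℝ → ℝ} (hG : ContDiff ℝ 2 G) (hφ : ContDiff ℝ 2 φ) (hZ : ContDiff ℝ 2 Z)
    {Λ g₀ g₁ : ℝ} (hΛ : 0 < Λ) (hg₁ : 0 ≤ g₁) (hG0 : ∀ u, |G u| ≤ g₀) (hG1 : ∀ u, |deriv G u| ≤ g₁ / Λ ^ 2)
    (hGv : ∀ u, Λ ^ 2 < u → G u = 0) {c : ℝ} (hc : 0 ≤ c) (s : ℝ) :
    |deriv (fun s => G (φ s ^ 2 + c) * Z s) s| ≤ 2 * g₁ * |deriv φ s| / Λ * |Z s| + g₀ * |deriv Z s| := by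
  have hA : ContDiff ℝ 2 (fun s => G (φ s ^ 2 + c)) := hG.comp (contDiff_two_sq_add hφ c)
  rw [deriv_mul₂ hA hZ s]
  have h1 := abs_deriv_radialComp_le hG hφ hΛ hg₁ hG1 hGv hc s
  have h0 := hG0 (φ s ^ 2 + c)
  calc _ ≤ |deriv (fun s => G (φ s ^ 2 + c)) s * Z s| + |G (φ s ^ 2 + c) * deriv Z s| := abs_add_le _ _
    _ = |deriv (fun s => G (φ s ^ 2 + c)) s| * |Z s| + |G (φ s ^ 2 + c)| * |deriv Z s| := by rw [abs_mul, abs_mul]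
    _ ≤ 2 * g₁ * |deriv φ s| / Λ * |Z s| + g₀ * |deriv Z s| :=
        add_le_add (mul_le_mul_of_nonneg_right h1 (abs_nonneg _)) (mul_le_mul_of_nonneg_right h0 (abs_nonneg _))

/-- **Order two — the symbol estimate of route (L2)**:
`|f″(s)| ≤ [(4g₂+2g₁)φ′(s)²/Λ² + 2g₁|φ″(s)|/Λ]·|Z(s)| + 4g₁|φ′(s)|/Λ·|Z′(s)| + g₀|Z″(s)|`, pointwise in `s`.
[cite: BenfattoGiulianiMastropietro2006, §2.5 proof of Lemma 2.2 (2.53)–(2.55)] -/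
theorem abs_iteratedDeriv_two_radialComp_mul_le {G φ Z : ℝ → ℝ} (hG : ContDiff ℝ 2 G) (hφ : ContDiff ℝ 2 φ)
    (hZ : ContDiff ℝ 2 Z) {Λ g₀ g₁ g₂ : ℝ} (hΛ : 0 < Λ) (hg₁ : 0 ≤ g₁) (hg₂ : 0 ≤ g₂) (hG0 : ∀ u, |G u| ≤ g₀)
    (hG1 : ∀ u, |deriv G u| ≤ g₁ / Λ ^ 2) (hG2 : ∀ u, |iteratedDeriv 2 G u| ≤ g₂ / Λ ^ 4)
    (hGv : ∀ u, Λ ^ 2 < u → G u = 0) {c : ℝ} (hc : 0 ≤ c) (s : ℝ) :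
    |iteratedDeriv 2 (fun s => G (φ s ^ 2 + c) * Z s) s| ≤
      ((4 * g₂ + 2 * g₁) * deriv φ s ^ 2 / Λ ^ 2 + 2 * g₁ * |iteratedDeriv 2 φ s| / Λ) * |Z s| +
        4 * g₁ * |deriv φ s| / Λ * |deriv Z s| + g₀ * |iteratedDeriv 2 Z s| := by
  have hA : ContDiff ℝ 2 (fun s => G (φ s ^ 2 + c)) := hG.comp (contDiff_two_sq_add hφ c)
  rw [iteratedDeriv_two_mul₂ hA hZ s]
  have h2 := abs_iteratedDeriv_two_radialComp_le hG hφ hΛ hg₁ hg₂ hG1 hG2 hGv hc s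
  have h1 := abs_deriv_radialComp_le hG hφ hΛ hg₁ hG1 hGv hc s
  have h0 := hG0 (φ s ^ 2 + c)
  calc _ ≤ |iteratedDeriv 2 (fun s => G (φ s ^ 2 + c)) s * Z s + 2 * (deriv (fun s => G (φ s ^ 2 + c)) s * deriv Z s)| +
          |G (φ s ^ 2 + c) * iteratedDeriv 2 Z s| := abs_add_le _ _
    _ ≤ |iteratedDeriv 2 (fun s => G (φ s ^ 2 + c)) s * Z s| + |2 * (deriv (fun s => G (φ s ^ 2 + c)) s * deriv Z s)| +
          |G (φ s ^ 2 + c) * iteratedDeriv 2 Z s| := by gcongr; exact abs_add_le _ _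
    _ = |iteratedDeriv 2 (fun s => G (φ s ^ 2 + c)) s| * |Z s| + 2 * (|deriv (fun s => G (φ s ^ 2 + c)) s| * |deriv Z s|) +
          |G (φ s ^ 2 + c)| * |iteratedDeriv 2 Z s| := by
        rw [abs_mul, abs_mul, abs_mul, abs_mul, abs_two]
    _ ≤ ((4 * g₂ + 2 * g₁) * deriv φ s ^ 2 / Λ ^ 2 + 2 * g₁ * |iteratedDeriv 2 φ s| / Λ) * |Z s| +
          2 * (2 * g₁ * |deriv φ s| / Λ * |deriv Z s|) + g₀ * |iteratedDeriv 2 Z s| := by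
        gcongr
    _ = _ := by ring

/-! ### §4 The SPACE line `φ(s) = e(q + s•w)` -/

section SpaceLine

variable {V : Type*} [NormedAddCommGroup V] [NormedSpace ℝ V]

/-- **Second line derivative of a multiplier symbol along a spatial line**: for `e : V → ℝ` of class `C²` with `‖D²e‖ ≤ K₂`, a profile
`G` as above and a `C²` line factor `Z`, the symbol `f(s) = G(e(q+s•w)² + c)·Z(s)` obeys, at every `s`,
`|f″(s)| ≤ [(4g₂+2g₁)(De(q+s•w)w)²/Λ² + 2g₁K₂‖w‖²/Λ]·|Z(s)| + 4g₁|De(q+s•w)w|/Λ·|Z′(s)| + g₀|Z″(s)|` — the first-order term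
`De·w` is the ANISOTROPIC one (small for `w` along the level curve of `e`). [cite: BenfattoGiulianiMastropietro2006, §2.5 proof of Lemma 2.2 (2.53)–(2.55)] -/
theorem abs_iteratedDeriv_two_symbol_spaceLine_le {e : V → ℝ} (he : ContDiff ℝ 2 e) {K₂ : ℝ}
    (hK₂ : ∀ p, ‖iteratedFDeriv ℝ 2 e p‖ ≤ K₂) {G Z : ℝ → ℝ} (hG : ContDiff ℝ 2 G) (hZ : ContDiff ℝ 2 Z)
    {Λ g₀ g₁ g₂ : ℝ} (hΛ : 0 < Λ) (hg₁ : 0 ≤ g₁) (hg₂ : 0 ≤ g₂) (hG0 : ∀ u, |G u| ≤ g₀)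
    (hG1 : ∀ u, |deriv G u| ≤ g₁ / Λ ^ 2) (hG2 : ∀ u, |iteratedDeriv 2 G u| ≤ g₂ / Λ ^ 4)
    (hGv : ∀ u, Λ ^ 2 < u → G u = 0) {c : ℝ} (hc : 0 ≤ c) (q w : V) (s : ℝ) :
    |iteratedDeriv 2 (fun s : ℝ => G (e (q + s • w) ^ 2 + c) * Z s) s| ≤
      ((4 * g₂ + 2 * g₁) * (fderiv ℝ e (q + s • w) w) ^ 2 / Λ ^ 2 + 2 * g₁ * (K₂ * ‖w‖ ^ 2) / Λ) * |Z s| +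
        4 * g₁ * |fderiv ℝ e (q + s • w) w| / Λ * |deriv Z s| + g₀ * |iteratedDeriv 2 Z s| := by
  have hφ : ContDiff ℝ 2 fun s : ℝ => e (q + s • w) := contDiff_two_line he q w
  have h := abs_iteratedDeriv_two_radialComp_mul_le (φ := fun s : ℝ => e (q + s • w)) hG hφ hZ hΛ hg₁ hg₂ hG0 hG1 hG2 hGv hc s
  rw [deriv_line_eq_fderiv he q w s] at h
  have hφ2 := abs_iteratedDeriv_two_line_le he hK₂ q w s
  have hK0 : 0 ≤ K₂ := le_trans (norm_nonneg _) (hK₂ q)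
  have hmono : ((4 * g₂ + 2 * g₁) * (fderiv ℝ e (q + s • w) w) ^ 2 / Λ ^ 2 +
      2 * g₁ * |iteratedDeriv 2 (fun s : ℝ => e (q + s • w)) s| / Λ) * |Z s| ≤
      ((4 * g₂ + 2 * g₁) * (fderiv ℝ e (q + s • w) w) ^ 2 / Λ ^ 2 + 2 * g₁ * (K₂ * ‖w‖ ^ 2) / Λ) * |Z s| := by
    refine mul_le_mul_of_nonneg_right ?_ (abs_nonneg _)
    gcongr
  linarith

/-- **First line derivative along a spatial line**: `|f′(s)| ≤ 2g₁|De(q+s•w)w|/Λ·|Z(s)| + g₀|Z′(s)|`. [folklore] -/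
theorem abs_deriv_symbol_spaceLine_le {e : V → ℝ} (he : ContDiff ℝ 2 e) {G Z : ℝ → ℝ} (hG : ContDiff ℝ 2 G)
    (hZ : ContDiff ℝ 2 Z) {Λ g₀ g₁ : ℝ} (hΛ : 0 < Λ) (hg₁ : 0 ≤ g₁) (hG0 : ∀ u, |G u| ≤ g₀)
    (hG1 : ∀ u, |deriv G u| ≤ g₁ / Λ ^ 2) (hGv : ∀ u, Λ ^ 2 < u → G u = 0) {c : ℝ} (hc : 0 ≤ c) (q w : V) (s : ℝ) :
    |deriv (fun s : ℝ => G (e (q + s • w) ^ 2 + c) * Z s) s| ≤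
      2 * g₁ * |fderiv ℝ e (q + s • w) w| / Λ * |Z s| + g₀ * |deriv Z s| := by
  have hφ : ContDiff ℝ 2 fun s : ℝ => e (q + s • w) := contDiff_two_line he q w
  have h := abs_deriv_radialComp_mul_le (φ := fun s : ℝ => e (q + s • w)) hG hφ hZ hΛ hg₁ hG0 hG1 hGv hc s
  rwa [deriv_line_eq_fderiv he q w s] at h

end SpaceLine

/-! ### §5 The TIME (Matsubara) line `φ(s) = k₀ + s·h₀` -/

/-- **Second derivative along the Matsubara line**: for `f(s) = G((k₀ + s h₀)² + c)·z` (`c = e(p)² ≥ 0`, `z` the momentum factor,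
constant in `k₀`): `|f″(s)| ≤ (4g₂ + 2g₁) h₀² |z| / Λ²`. [cite: BenfattoGiulianiMastropietro2006, §2.5 proof of Lemma 2.2 (2.52), (2.56)] -/
theorem abs_iteratedDeriv_two_symbol_timeLine_le {G : ℝ → ℝ} (hG : ContDiff ℝ 2 G) {Λ g₁ g₂ : ℝ} (hΛ : 0 < Λ)
    (hg₁ : 0 ≤ g₁) (hg₂ : 0 ≤ g₂) (hG1 : ∀ u, |deriv G u| ≤ g₁ / Λ ^ 2) (hG2 : ∀ u, |iteratedDeriv 2 G u| ≤ g₂ / Λ ^ 4)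
    (hGv : ∀ u, Λ ^ 2 < u → G u = 0) {c : ℝ} (hc : 0 ≤ c) (k₀ h₀ z s : ℝ) :
    |iteratedDeriv 2 (fun s : ℝ => G ((k₀ + s * h₀) ^ 2 + c) * z) s| ≤ (4 * g₂ + 2 * g₁) * h₀ ^ 2 * |z| / Λ ^ 2 := by
  have hφ : ContDiff ℝ 2 fun s : ℝ => k₀ + s * h₀ := contDiff_const.add (contDiff_id.mul contDiff_const)
  have hA : ContDiff ℝ 2 (fun s => G ((k₀ + s * h₀) ^ 2 + c)) := hG.comp (contDiff_two_sq_add hφ c)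
  have hmul : (fun s : ℝ => G ((k₀ + s * h₀) ^ 2 + c) * z) = fun s => z * G ((k₀ + s * h₀) ^ 2 + c) := by
    funext s; ring
  rw [hmul, iteratedDeriv_const_mul z hA.contDiffAt, abs_mul]
  have hd1 : ∀ s, deriv (fun s : ℝ => k₀ + s * h₀) s = h₀ := fun s => by
    have : HasDerivAt (fun s : ℝ => k₀ + s * h₀) (1 * h₀) s := ((hasDerivAt_id s).mul_const h₀).const_add k₀
    rw [this.deriv]; ring
  have hd2 : ∀ s, iteratedDeriv 2 (fun s : ℝ => k₀ + s * h₀) s = 0 := fun s => by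
    rw [iteratedDeriv_succ, iteratedDeriv_one]
    have : deriv (fun s : ℝ => k₀ + s * h₀) = fun _ => h₀ := funext hd1
    rw [this, deriv_const]
  have h := abs_iteratedDeriv_two_radialComp_le (φ := fun s : ℝ => k₀ + s * h₀) hG hφ hΛ hg₁ hg₂ hG1 hG2 hGv hc s
  rw [hd1, hd2, abs_zero, mul_zero, zero_div, add_zero] at h
  calc |z| * |iteratedDeriv 2 (fun s => G ((k₀ + s * h₀) ^ 2 + c)) s| ≤ |z| * ((4 * g₂ + 2 * g₁) * h₀ ^ 2 / Λ ^ 2) :=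
        mul_le_mul_of_nonneg_left h (abs_nonneg _)
    _ = _ := by ring

/-- The Matsubara-line symbol is `C²`. [folklore] -/
theorem contDiff_two_symbol_timeLine {G : ℝ → ℝ} (hG : ContDiff ℝ 2 G) (c k₀ h₀ z : ℝ) :
    ContDiff ℝ 2 fun s : ℝ => G ((k₀ + s * h₀) ^ 2 + c) * z :=
  (hG.comp (contDiff_two_sq_add (contDiff_const.add (contDiff_id.mul contDiff_const)) c)).mul contDiff_const

/-! ### §6 Profiles: vanishing derivatives and products of two profiles -/

/-- **The product of two cutoff profiles is a cutoff profile at the finer scale**: if `|Gᵢ| ≤ aᵢ`, `|Gᵢ′| ≤ bᵢ/Λᵢ²`,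
`|Gᵢ″| ≤ dᵢ/Λᵢ⁴` and `0 < Λ₁ ≤ Λ₂`, then `G₁G₂` has `|·| ≤ a₁a₂`, `|(G₁G₂)′| ≤ (b₁a₂ + a₁b₂)/Λ₁²`,
`|(G₁G₂)″| ≤ (d₁a₂ + 2b₁b₂ + a₁d₂)/Λ₁⁴`, and vanishes above `Λ₁²` if `G₁` does. [folklore] -/
theorem profile_mul {G₁ G₂ : ℝ → ℝ} (h₁ : ContDiff ℝ 2 G₁) (h₂ : ContDiff ℝ 2 G₂) {Λ₁ Λ₂ a₁ a₂ b₁ b₂ d₁ d₂ : ℝ}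
    (hΛ₁ : 0 < Λ₁) (hΛ₁₂ : Λ₁ ≤ Λ₂) (ha₁ : 0 ≤ a₁) (hb₁ : 0 ≤ b₁) (hb₂ : 0 ≤ b₂) (hd₂ : 0 ≤ d₂)
    (hA₁ : ∀ u, |G₁ u| ≤ a₁) (hB₁ : ∀ u, |deriv G₁ u| ≤ b₁ / Λ₁ ^ 2) (hD₁ : ∀ u, |iteratedDeriv 2 G₁ u| ≤ d₁ / Λ₁ ^ 4)
    (hA₂ : ∀ u, |G₂ u| ≤ a₂) (hB₂ : ∀ u, |deriv G₂ u| ≤ b₂ / Λ₂ ^ 2) (hD₂ : ∀ u, |iteratedDeriv 2 G₂ u| ≤ d₂ / Λ₂ ^ 4)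
    (hV₁ : ∀ u, Λ₁ ^ 2 < u → G₁ u = 0) :
    ContDiff ℝ 2 (fun u => G₁ u * G₂ u) ∧ (∀ u, |G₁ u * G₂ u| ≤ a₁ * a₂) ∧
      (∀ u, |deriv (fun u => G₁ u * G₂ u) u| ≤ (b₁ * a₂ + a₁ * b₂) / Λ₁ ^ 2) ∧
      (∀ u, |iteratedDeriv 2 (fun u => G₁ u * G₂ u) u| ≤ (d₁ * a₂ + 2 * b₁ * b₂ + a₁ * d₂) / Λ₁ ^ 4) ∧
      (∀ u, Λ₁ ^ 2 < u → G₁ u * G₂ u = 0) := by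
  have hB₂' : ∀ u, |deriv G₂ u| ≤ b₂ / Λ₁ ^ 2 := fun u =>
    (hB₂ u).trans (div_le_div_of_nonneg_left hb₂ (by positivity) (pow_le_pow_left₀ hΛ₁.le hΛ₁₂ 2))
  have hD₂' : ∀ u, |iteratedDeriv 2 G₂ u| ≤ d₂ / Λ₁ ^ 4 := fun u =>
    (hD₂ u).trans (div_le_div_of_nonneg_left hd₂ (by positivity) (pow_le_pow_left₀ hΛ₁.le hΛ₁₂ 4))
  refine ⟨h₁.mul h₂, fun u => ?_, fun u => ?_, fun u => ?_, fun u hu => by rw [hV₁ u hu, zero_mul]⟩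
  · rw [abs_mul]; exact mul_le_mul (hA₁ u) (hA₂ u) (abs_nonneg _) ha₁
  · rw [deriv_mul₂ h₁ h₂ u]
    calc _ ≤ |deriv G₁ u * G₂ u| + |G₁ u * deriv G₂ u| := abs_add_le _ _
      _ = |deriv G₁ u| * |G₂ u| + |G₁ u| * |deriv G₂ u| := by rw [abs_mul, abs_mul]
      _ ≤ b₁ / Λ₁ ^ 2 * a₂ + a₁ * (b₂ / Λ₁ ^ 2) :=
          add_le_add (mul_le_mul (hB₁ u) (hA₂ u) (abs_nonneg _) (by positivity))
            (mul_le_mul (hA₁ u) (hB₂' u) (abs_nonneg _) ha₁)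
      _ = (b₁ * a₂ + a₁ * b₂) / Λ₁ ^ 2 := by ring
  · rw [iteratedDeriv_two_mul₂ h₁ h₂ u]
    calc _ ≤ |iteratedDeriv 2 G₁ u * G₂ u + 2 * (deriv G₁ u * deriv G₂ u)| + |G₁ u * iteratedDeriv 2 G₂ u| := abs_add_le _ _
      _ ≤ |iteratedDeriv 2 G₁ u * G₂ u| + |2 * (deriv G₁ u * deriv G₂ u)| + |G₁ u * iteratedDeriv 2 G₂ u| := by
          gcongr; exact abs_add_le _ _
      _ = |iteratedDeriv 2 G₁ u| * |G₂ u| + 2 * (|deriv G₁ u| * |deriv G₂ u|) + |G₁ u| * |iteratedDeriv 2 G₂ u| := by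
          rw [abs_mul, abs_mul, abs_mul, abs_mul, abs_two]
      _ ≤ d₁ / Λ₁ ^ 4 * a₂ + 2 * (b₁ / Λ₁ ^ 2 * (b₂ / Λ₁ ^ 2)) + a₁ * (d₂ / Λ₁ ^ 4) :=
          add_le_add (add_le_add (mul_le_mul (hD₁ u) (hA₂ u) (abs_nonneg _) (le_trans (abs_nonneg _) (hD₁ u)))
            (mul_le_mul_of_nonneg_left (mul_le_mul (hB₁ u) (hB₂' u) (abs_nonneg _) (le_trans (abs_nonneg _) (hB₁ u)))
              (by norm_num)))
            (mul_le_mul (hA₁ u) (hD₂' u) (abs_nonneg _) ha₁)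
      _ = (d₁ * a₂ + 2 * b₁ * b₂ + a₁ * d₂) / Λ₁ ^ 4 := by ring

end Summit.HubbardSuperconductivity.HubbardSuperconductivity.Theorems.TorusFourierL2

end
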